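import Summits.Ventures.LatticeQCDFlow.Scoring.MadrasSokalWindow
import Summits.Ventures.LatticeQCDFlow.Scoring.DeltaMethod

/-!
# The DATA-CHOSEN Madras–Sokal window: at a strict population crossing the empirical window equals the population window with probability `→ 1`, and every limit law of a windowed statistic survives the selection

HONEST FRAMING: exact (Metropolis-corrected) sampling algorithms for lattice gauge theory;
figures of merit are autocorrelation/cost numbers at stated couplings and volumes; no
continuum-physics claim.

Venture `LatticeQCDFlow` (cell pub-lqcd), sub-topic `Scoring`; FANOUT row 16 (`su2-base`), GEN-8.
NEW WORK of the cell over row 11's `Scoring/MadrasSokalWindow` (`IsMSWindow c τW W`: THE first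
`W ≥ 1` with `c · τW W ≤ W`, scorer B's window of record at `c = 6`, scorer A's cross-check scan),
row 4's `Scoring/DeltaMethod` (a limit law pins the centring) and Mathlib's
`tendstoInDistribution_of_tendstoInMeasure_sub`; no definition of a published notion, nothing cited
as a fact.  Printed counterpart NAMED ONLY: Madras–Sokal 1988 (J. Stat. Phys. 50) §/App. on the
automatic windowing procedure.

WHY.  Every law-of-the-error statement of the cell is proved at a FIXED window `W`
(GEN-6 `MadrasSokalErrorFormula`, GEN-7 `LagProductCLT` and the staged ratio CLT; row 13's Γ-method
consistency at deterministic windows, `…GammaMethodDataWindow` for CLIPPED growing rules), while both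
frozen scorers read their statistic at a window CHOSEN FROM THE SAME DATA, `Ŵ_N = W*(c; τ̂_N(·))`.
GEN-7 listed 'data-chosen windows `W(τ̂)`' as NOT CLAIMED.  This file closes that gap in the regime
of those theorems (fixed `c`, fixed autocorrelation function, `N → ∞`): if the population curve
`W ↦ τ_W` crosses the line `W = c τ_W` STRICTLY at its Madras–Sokal window `w` (the generic case —
equality `c τ_w = w` is a coincidence of measure zero in `c`), and the windowed estimates are
consistent lag window by lag window (`τ̂_N(W) → τ_W` in probability for `1 ≤ W ≤ w`, which any
`√N`-limit law supplies, `tendstoInMeasure_of_tendstoInDistribution_scaled`), then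
`P(Ŵ_N ≠ w) → 0`, and THEREFORE any statistic read at `Ŵ_N` has the limit law it has at `w`.

## Contents

* §1 `tendstoInMeasure_sub_of_measure_ne_tendsto_zero`, **`tendstoInDistribution_of_measure_ne_tendsto_zero`**
  — a limit law survives modification on events of vanishing probability (Slutsky with a difference
  that is `0` off those events); `measurable_apply_dataIndex`, **`tendstoInDistribution_dataIndex`** —
  a family `T_N(W)` read at a data-chosen index `Ŵ_N` with `P(Ŵ_N ≠ w) → 0` inherits the limit law of
  `T_N(w)`; `tendsto_measure_of_eqOn_compl`, `tendsto_measure_dataIndex` — the same for PROBABILITIES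
  of window-indexed events (the currency of coverage statements).
* §2 `IsStrictMSWindow` (strict crossing), `IsStrictMSWindow.isMSWindow`,
  **`IsStrictMSWindow.exists_margin`** — a uniform margin `δ > 0`: every curve within `δ` of `τ_·` on
  `1 ≤ W ≤ w` has THE SAME Madras–Sokal window `w` (deterministic, finitely many strict inequalities).
* §3 **`tendsto_measure_not_isMSWindow`** — consistency lag window by lag window ⇒
  `P(w is not the MS window of τ̂_N) → 0` (finite union bound); **`tendsto_measure_msWindowSel_ne`** —
  for any selector returning `w` whenever `w` IS the MS window of the empirical curve (scorer B
  `ms_window`, scorer A's scan, whatever they return when no crossing exists): `P(Ŵ_N ≠ w) → 0`.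
* §4 **`tendstoInDistribution_at_msWindow`** — THE TRANSFER: `T_N(w) ⇒ Z` ⇒ `T_N(Ŵ_N) ⇒ Z`;
  `tendsto_measure_at_msWindow` — `P(A_N(w)) → p` ⇒ `P(A_N(Ŵ_N)) → p` (coverage at the data window);
  **`tendstoInDistribution_tauHat_at_msWindow`** — the instance of record,
  `√N (τ̂_N(Ŵ_N) − τ_{Ŵ_N}) ⇒ Z` from `√N (τ̂_N(w) − τ_w) ⇒ Z` plus consistency below `w`
  (random centring `τ_{Ŵ_N}` included: it equals `τ_w` on the good event);
  `tendstoInMeasure_of_clt_family` — the consistency hypothesis from per-window `√N`-laws.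
* §5 `isStrictMSWindow_of_not_mem_range`, `volume_range_window_div`,
  `exists_isStrictMSWindow_geometric` — strictness is GENERIC: it holds for every `c` off the
  countable (Lebesgue-null) set `{W/τ_W}`; on C-1 a strict MS window exists for every such `c ≥ 0`.

NOT CLAIMED: the non-strict (tangential) crossing `c τ_w = w`, where `Ŵ_N` genuinely fluctuates
between two windows and the limit law is a mixture; windows growing with `N` (row 13's bracket
regime); the finite `W_max` cut of real data beyond 'the selector returns `w` when `w` is the MS
window' (true whenever `w ≤ W_max`); Wolff's `S`-rule (its criterion involves `N` explicitly —
a different regime); any rate; any number about row 16's chains.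
-/

noncomputable section

open MeasureTheory ProbabilityTheory Filter Finset
open scoped Topology ENNReal

namespace Summit.Ventures.LatticeQCDFlow.Scoring

/-! ## §1 Limit laws survive modification on events of vanishing probability -/

section Transfer

variable {Ω : Type*} [MeasurableSpace Ω] {P : Measure Ω}
variable {Ω' : Type*} [MeasurableSpace Ω'] {P' : Measure Ω'}
variable {E : Type*} [SeminormedAddCommGroup E] [MeasurableSpace E]

omit [MeasurableSpace E] in
/-- If `Y_N = X_N` outside events whose probability tends to `0`, then `Y_N − X_N → 0` in measure. -/
theorem tendstoInMeasure_sub_of_measure_ne_tendsto_zero {X Y : ℕ → Ω → E}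
    (h : Tendsto (fun N => P {ω | Y N ω ≠ X N ω}) atTop (𝓝 0)) :
    TendstoInMeasure P (Y - X) atTop 0 := by
  intro ε hε
  refine tendsto_of_tendsto_of_tendsto_of_le_of_le tendsto_const_nhds h (fun _ => bot_le)
    fun N => measure_mono fun ω hω => ?_
  simp only [Set.mem_setOf_eq, Pi.sub_apply, Pi.zero_apply] at hω ⊢
  intro heq
  rw [heq, sub_self, edist_self] at hω
  exact absurd hω (not_le.2 hε)

variable [IsProbabilityMeasure P] [IsProbabilityMeasure P'] [SecondCountableTopology E] [BorelSpace E]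

/-- **A limit law survives modification on events of vanishing probability**: `X_N ⇒ Z` and
`P(Y_N ≠ X_N) → 0` ⇒ `Y_N ⇒ Z`. -/
theorem tendstoInDistribution_of_measure_ne_tendsto_zero {X Y : ℕ → Ω → E} {Z : Ω' → E}
    (hX : TendstoInDistribution X atTop Z (fun _ => P) P') (hY : ∀ N, AEMeasurable (Y N) P)
    (h : Tendsto (fun N => P {ω | Y N ω ≠ X N ω}) atTop (𝓝 0)) :
    TendstoInDistribution Y atTop Z (fun _ => P) P' :=
  tendstoInDistribution_of_tendstoInMeasure_sub Y Z hX
    (tendstoInMeasure_sub_of_measure_ne_tendsto_zero h) hY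

omit [SeminormedAddCommGroup E] [IsProbabilityMeasure P] [SecondCountableTopology E] [BorelSpace E] in
/-- A measurable family `T(W)` read at a measurable data-chosen index `Ŵ` is measurable
(`ℕ` is countable). -/
theorem measurable_apply_dataIndex {T : ℕ → Ω → E} {Wsel : Ω → ℕ} (hT : ∀ W, Measurable (T W))
    (hW : Measurable Wsel) : Measurable fun ω => T (Wsel ω) ω :=
  (measurable_from_prod_countable_left (f := fun p : Ω × ℕ => T p.2 p.1) hT).comp
    (measurable_id.prodMk hW)

/-- **A statistic read at a data-chosen index inherits the limit law at the limiting index**: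
`T_N(w) ⇒ Z` and `P(Ŵ_N ≠ w) → 0` ⇒ `T_N(Ŵ_N) ⇒ Z`. -/
theorem tendstoInDistribution_dataIndex {T : ℕ → ℕ → Ω → E} {Wsel : ℕ → Ω → ℕ} {w : ℕ}
    {Z : Ω' → E} (hT : TendstoInDistribution (fun N => T N w) atTop Z (fun _ => P) P')
    (hm : ∀ N, AEMeasurable (fun ω => T N (Wsel N ω) ω) P)
    (hW : Tendsto (fun N => P {ω | Wsel N ω ≠ w}) atTop (𝓝 0)) :
    TendstoInDistribution (fun N ω => T N (Wsel N ω) ω) atTop Z (fun _ => P) P' := by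
  refine tendstoInDistribution_of_measure_ne_tendsto_zero hT hm ?_
  refine tendsto_of_tendsto_of_tendsto_of_le_of_le tendsto_const_nhds hW (fun _ => bot_le)
    fun N => measure_mono fun ω hω => ?_
  simp only [Set.mem_setOf_eq] at hω ⊢
  intro heq
  exact hω (by rw [heq])

omit [IsProbabilityMeasure P] in
/-- **Probabilities of events transfer along events of vanishing probability**: if `B_N` and `A_N`
agree outside `D_N` with `P(D_N) → 0` and `P(A_N) → p`, then `P(B_N) → p` (coverage statements are of
this shape). -/
theorem tendsto_measure_of_eqOn_compl {A B D : ℕ → Set Ω} {p : ℝ≥0∞}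
    (hA : Tendsto (fun N => P (A N)) atTop (𝓝 p)) (hD : Tendsto (fun N => P (D N)) atTop (𝓝 0))
    (heq : ∀ N ω, ω ∉ D N → (ω ∈ B N ↔ ω ∈ A N)) :
    Tendsto (fun N => P (B N)) atTop (𝓝 p) := by
  have hBA : ∀ N, P (B N) ≤ P (A N) + P (D N) := fun N =>
    (measure_mono fun ω hω => by
      by_cases hD : ω ∈ D N
      · exact Or.inr hD
      · exact Or.inl ((heq N ω hD).1 hω)).trans (measure_union_le _ _)
  have hAB : ∀ N, P (A N) ≤ P (B N) + P (D N) := fun N =>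
    (measure_mono fun ω hω => by
      by_cases hD : ω ∈ D N
      · exact Or.inr hD
      · exact Or.inl ((heq N ω hD).2 hω)).trans (measure_union_le _ _)
  have hup : Tendsto (fun N => P (A N) + P (D N)) atTop (𝓝 p) := by
    simpa only [add_zero] using hA.add hD
  have hlo : Tendsto (fun N => P (A N) - P (D N)) atTop (𝓝 p) := by
    simpa only [tsub_zero] using ENNReal.Tendsto.sub hA hD (Or.inr ENNReal.zero_ne_top)
  exact tendsto_of_tendsto_of_tendsto_of_le_of_le hlo hup
    (fun N => tsub_le_iff_right.2 (hAB N)) hBA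

omit [IsProbabilityMeasure P] in
/-- **Window-indexed events read at a data-chosen index**: `P(A_N(w)) → p` and `P(Ŵ_N ≠ w) → 0`
⇒ `P(A_N(Ŵ_N)) → p`. -/
theorem tendsto_measure_dataIndex {A : ℕ → ℕ → Set Ω} {Wsel : ℕ → Ω → ℕ} {w : ℕ} {p : ℝ≥0∞}
    (hA : Tendsto (fun N => P (A N w)) atTop (𝓝 p))
    (hW : Tendsto (fun N => P {ω | Wsel N ω ≠ w}) atTop (𝓝 0)) :
    Tendsto (fun N => P {ω | ω ∈ A N (Wsel N ω)}) atTop (𝓝 p) :=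
  tendsto_measure_of_eqOn_compl hA hW fun N ω hω => by
    simp only [Set.mem_setOf_eq, not_not] at hω
    simp only [Set.mem_setOf_eq, hω]

end Transfer

/-! ## §2 Strict crossing and its margin (deterministic) -/

section Strict

/-- `W` is a STRICT Madras–Sokal window of the curve `τW` at constant `c`: the first `W ≥ 1` with
`c · τW W ≤ W`, the inequality holding STRICTLY at `W` (below `W` it fails strictly by the definition of
`IsMSWindow`).  The generic case: `c τ_W = W` exactly is a coincidence. [ours] -/
def IsStrictMSWindow (c : ℝ) (τW : ℕ → ℝ) (W : ℕ) : Prop :=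
  1 ≤ W ∧ c * τW W < W ∧ ∀ W', 1 ≤ W' → W' < W → (W' : ℝ) < c * τW W'

/-- A strict MS window is the MS window. -/
theorem IsStrictMSWindow.isMSWindow {c : ℝ} {τW : ℕ → ℝ} {W : ℕ} (h : IsStrictMSWindow c τW W) :
    IsMSWindow c τW W :=
  ⟨h.1, h.2.1.le, h.2.2⟩

/-- **THE MARGIN.**  At a strict crossing with `c > 0` there is `δ > 0` such that EVERY curve within `δ`
of `τW` on `1 ≤ W ≤ w` has the same Madras–Sokal window `w` (finitely many strict inequalities, each
with slack at least `c δ`). -/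
theorem IsStrictMSWindow.exists_margin {c : ℝ} {τW : ℕ → ℝ} {w : ℕ} (h : IsStrictMSWindow c τW w)
    (hc : 0 < c) :
    ∃ δ : ℝ, 0 < δ ∧ ∀ τ' : ℕ → ℝ,
      (∀ W, 1 ≤ W → W ≤ w → |τ' W - τW W| < δ) → IsMSWindow c τ' w := by
  obtain ⟨hw1, hww, hlt⟩ := h
  -- the slack of each of the finitely many inequalities
  let g : ℕ → ℝ := fun W => if W = w then (w : ℝ) - c * τW w else c * τW W - W
  have hne : (Finset.Icc 1 w).Nonempty := ⟨w, Finset.mem_Icc.2 ⟨hw1, le_rfl⟩⟩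
  have hgpos : ∀ W ∈ Finset.Icc 1 w, 0 < g W := by
    intro W hW
    rcases Finset.mem_Icc.1 hW with ⟨h1, h2⟩
    by_cases hWw : W = w
    · subst hWw; simp only [g, if_true]; linarith
    · simp only [g, if_neg hWw]; linarith [hlt W h1 (lt_of_le_of_ne h2 hWw)]
  have hinf : 0 < (Finset.Icc 1 w).inf' hne g := (Finset.lt_inf'_iff hne).2 hgpos
  refine ⟨(Finset.Icc 1 w).inf' hne g / c, div_pos hinf hc, fun τ' hτ' => ?_⟩
  -- `c δ ≤ g W` on the range
  have hcδ : ∀ W ∈ Finset.Icc 1 w, c * ((Finset.Icc 1 w).inf' hne g / c) ≤ g W := by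
    intro W hW
    rw [mul_div_cancel₀ _ hc.ne']
    exact Finset.inf'_le g hW
  have hdev : ∀ W ∈ Finset.Icc 1 w, |c * τ' W - c * τW W| < g W := by
    intro W hW
    rcases Finset.mem_Icc.1 hW with ⟨h1, h2⟩
    rw [← mul_sub, abs_mul, abs_of_pos hc]
    exact (mul_lt_mul_of_pos_left (hτ' W h1 h2) hc).trans_le (hcδ W hW)
  refine ⟨hw1, ?_, fun W' h1 h2 => ?_⟩
  · have hd := hdev w (Finset.mem_Icc.2 ⟨hw1, le_rfl⟩)
    simp only [g, if_true] at hd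
    linarith [(abs_lt.1 hd).2]
  · have hd := hdev W' (Finset.mem_Icc.2 ⟨h1, h2.le⟩)
    simp only [g, if_neg h2.ne] at hd
    linarith [(abs_lt.1 hd).1]

end Strict

/-! ## §3 The empirical window equals the population window with probability `→ 1` -/

section Empirical

variable {Ω : Type*} [MeasurableSpace Ω] {P : Measure Ω}

/-- **CONSISTENCY OF THE EMPIRICAL MADRAS–SOKAL WINDOW.**  `c > 0`, `w` a strict MS window of the
population curve `τW`, and `τ̂_N(W) → τ_W` in measure for each `1 ≤ W ≤ w`.  Then the probability that
`w` is NOT the MS window of the empirical curve `W ↦ τ̂_N(W)` tends to `0`. -/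
theorem tendsto_measure_not_isMSWindow {τhat : ℕ → ℕ → Ω → ℝ} {τW : ℕ → ℝ} {c : ℝ} {w : ℕ}
    (hc : 0 < c) (hw : IsStrictMSWindow c τW w)
    (hconv : ∀ W, 1 ≤ W → W ≤ w → TendstoInMeasure P (fun N => τhat N W) atTop fun _ => τW W) :
    Tendsto (fun N => P {ω | ¬ IsMSWindow c (fun W => τhat N W ω) w}) atTop (𝓝 0) := by
  obtain ⟨δ, hδ, hmargin⟩ := hw.exists_margin hc
  -- the bad event lies in a finite union of per-window deviation events
  have hsub : ∀ N, {ω | ¬ IsMSWindow c (fun W => τhat N W ω) w}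
      ⊆ ⋃ W ∈ Finset.Icc 1 w, {ω | δ ≤ dist (τhat N W ω) (τW W)} := by
    intro N ω hω
    by_contra hno
    simp only [Set.mem_iUnion, Set.mem_setOf_eq, not_exists, not_le, exists_prop, not_and] at hno
    exact hω (hmargin _ fun W h1 h2 => by
      rw [← Real.dist_eq]; exact hno W (Finset.mem_Icc.2 ⟨h1, h2⟩))
  have hle : ∀ N, P {ω | ¬ IsMSWindow c (fun W => τhat N W ω) w}
      ≤ ∑ W ∈ Finset.Icc 1 w, P {ω | δ ≤ dist (τhat N W ω) (τW W)} :=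
    fun N => (measure_mono (hsub N)).trans (measure_biUnion_finset_le _ _)
  have h0 : Tendsto (fun N => ∑ W ∈ Finset.Icc 1 w, P {ω | δ ≤ dist (τhat N W ω) (τW W)})
      atTop (𝓝 0) := by
    rw [← Finset.sum_const_zero (s := Finset.Icc 1 w)]
    -- hmm: `∑ _ ∈ s, 0 = 0`; restate the target as the sum of the limits
    have h := tendsto_finsetSum (Finset.Icc 1 w) fun W hW =>
      (tendstoInMeasure_iff_dist.1
        (hconv W (Finset.mem_Icc.1 hW).1 (Finset.mem_Icc.1 hW).2)) δ hδ
    simpa only [Finset.sum_const_zero] using h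
  exact tendsto_of_tendsto_of_tendsto_of_le_of_le tendsto_const_nhds h0 (fun _ => bot_le) hle

/-- **`P(Ŵ_N ≠ w) → 0`** for any selector that returns `w` whenever `w` IS the Madras–Sokal window of
the empirical curve (scorer B `ms_window` and scorer A's scan do: the MS window is unique,
`isMSWindow_unique`, and they return the first crossing). -/
theorem tendsto_measure_msWindowSel_ne {τhat : ℕ → ℕ → Ω → ℝ} {τW : ℕ → ℝ} {c : ℝ} {w : ℕ}
    (hc : 0 < c) (hw : IsStrictMSWindow c τW w)
    (hconv : ∀ W, 1 ≤ W → W ≤ w → TendstoInMeasure P (fun N => τhat N W) atTop fun _ => τW W)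
    {Wsel : ℕ → Ω → ℕ} (hsel : ∀ N ω, IsMSWindow c (fun W => τhat N W ω) w → Wsel N ω = w) :
    Tendsto (fun N => P {ω | Wsel N ω ≠ w}) atTop (𝓝 0) :=
  tendsto_of_tendsto_of_tendsto_of_le_of_le tendsto_const_nhds
    (tendsto_measure_not_isMSWindow hc hw hconv) (fun _ => bot_le)
    fun N => measure_mono fun ω hω hms => hω (hsel N ω hms)

end Empirical

/-! ## §4 The transfer: limit laws at the data-chosen window -/

section AtWindow

variable {Ω : Type*} [MeasurableSpace Ω] {P : Measure Ω} [IsProbabilityMeasure P]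
variable {Ω' : Type*} [MeasurableSpace Ω'] {P' : Measure Ω'} [IsProbabilityMeasure P']
variable {E : Type*} [SeminormedAddCommGroup E] [MeasurableSpace E] [SecondCountableTopology E]
  [BorelSpace E]

/-- **THE LIMIT LAW AT THE DATA-CHOSEN MADRAS–SOKAL WINDOW.**  `T_N(W)` any windowed statistics with
`T_N(w) ⇒ Z`; `c > 0`; `w` a strict MS window of the population curve `τW`; the windowed estimates
`τ̂_N(W)` consistent for `1 ≤ W ≤ w`; `Ŵ_N` a selector returning `w` whenever `w` is the MS window of
`τ̂_N(·)`.  Then `T_N(Ŵ_N) ⇒ Z`. -/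
theorem tendstoInDistribution_at_msWindow {T : ℕ → ℕ → Ω → E} {Z : Ω' → E}
    {τhat : ℕ → ℕ → Ω → ℝ} {τW : ℕ → ℝ} {c : ℝ} {w : ℕ} {Wsel : ℕ → Ω → ℕ}
    (hT : TendstoInDistribution (fun N => T N w) atTop Z (fun _ => P) P')
    (hm : ∀ N, AEMeasurable (fun ω => T N (Wsel N ω) ω) P)
    (hc : 0 < c) (hw : IsStrictMSWindow c τW w)
    (hconv : ∀ W, 1 ≤ W → W ≤ w → TendstoInMeasure P (fun N => τhat N W) atTop fun _ => τW W)
    (hsel : ∀ N ω, IsMSWindow c (fun W => τhat N W ω) w → Wsel N ω = w) :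
    TendstoInDistribution (fun N ω => T N (Wsel N ω) ω) atTop Z (fun _ => P) P' :=
  tendstoInDistribution_dataIndex hT hm (tendsto_measure_msWindowSel_ne hc hw hconv hsel)

omit [IsProbabilityMeasure P] in
/-- **COVERAGE-TYPE STATEMENTS AT THE DATA-CHOSEN WINDOW.**  If the window-`w` event has
`P(A_N(w)) → p` (e.g. '`τ_w` within `z` printed bars of `τ̂_N(w)`', whose limit the coverage theorems
compute), then under the same hypotheses the event read at `Ŵ_N` has `P(A_N(Ŵ_N)) → p`. -/
theorem tendsto_measure_at_msWindow {A : ℕ → ℕ → Set Ω} {p : ℝ≥0∞}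
    {τhat : ℕ → ℕ → Ω → ℝ} {τW : ℕ → ℝ} {c : ℝ} {w : ℕ} {Wsel : ℕ → Ω → ℕ}
    (hA : Tendsto (fun N => P (A N w)) atTop (𝓝 p))
    (hc : 0 < c) (hw : IsStrictMSWindow c τW w)
    (hconv : ∀ W, 1 ≤ W → W ≤ w → TendstoInMeasure P (fun N => τhat N W) atTop fun _ => τW W)
    (hsel : ∀ N ω, IsMSWindow c (fun W => τhat N W ω) w → Wsel N ω = w) :
    Tendsto (fun N => P {ω | ω ∈ A N (Wsel N ω)}) atTop (𝓝 p) :=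
  tendsto_measure_dataIndex hA (tendsto_measure_msWindowSel_ne hc hw hconv hsel)

/-- **The consistency hypothesis from a family of `√N`-laws**: if `√N (τ̂_N(W) − τ_W) ⇒ Z_W` for each
`1 ≤ W ≤ w`, then `τ̂_N(W) → τ_W` in probability there (row 4's
`tendstoInMeasure_of_tendstoInDistribution_scaled`). -/
theorem tendstoInMeasure_of_clt_family {τhat : ℕ → ℕ → Ω → ℝ} {τW : ℕ → ℝ} {w : ℕ}
    {ZW : ℕ → Ω' → ℝ}
    (hclt : ∀ W, 1 ≤ W → W ≤ w → TendstoInDistribution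
      (fun (N : ℕ) ω => Real.sqrt N * (τhat N W ω - τW W)) atTop (ZW W) (fun _ => P) P') :
    ∀ W, 1 ≤ W → W ≤ w → TendstoInMeasure P (fun N => τhat N W) atTop fun _ => τW W :=
  fun W h1 h2 => CardConsistency.tendstoInMeasure_of_tendstoInDistribution_scaled
    (Real.tendsto_sqrt_atTop.comp tendsto_natCast_atTop_atTop) (hclt W h1 h2)

/-- **THE INSTANCE OF RECORD: `√N (τ̂_N(Ŵ_N) − τ_{Ŵ_N}) ⇒ Z`.**  Measurable windowed estimates
`τ̂_N(W)` with `√N (τ̂_N(w) − τ_w) ⇒ Z` at the strict population MS window `w` (`c > 0`) and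
consistency for `1 ≤ W ≤ w`; a measurable selector `Ŵ_N` returning `w` whenever `w` is the MS window
of `τ̂_N(·)`.  Then the statistic AS PRINTED — estimate and window from the same data, centred at the
windowed truth of the window it chose — has the fixed-window limit law. -/
theorem tendstoInDistribution_tauHat_at_msWindow {Z : Ω' → ℝ}
    {τhat : ℕ → ℕ → Ω → ℝ} {τW : ℕ → ℝ} {c : ℝ} {w : ℕ} {Wsel : ℕ → Ω → ℕ}
    (hclt : TendstoInDistribution (fun (N : ℕ) ω => Real.sqrt N * (τhat N w ω - τW w)) atTop Z
      (fun _ => P) P')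
    (hτm : ∀ N W, Measurable (τhat N W)) (hWm : ∀ N, Measurable (Wsel N))
    (hc : 0 < c) (hw : IsStrictMSWindow c τW w)
    (hconv : ∀ W, 1 ≤ W → W ≤ w → TendstoInMeasure P (fun N => τhat N W) atTop fun _ => τW W)
    (hsel : ∀ N ω, IsMSWindow c (fun W => τhat N W ω) w → Wsel N ω = w) :
    TendstoInDistribution
      (fun (N : ℕ) ω => Real.sqrt N * (τhat N (Wsel N ω) ω - τW (Wsel N ω))) atTop Z (fun _ => P) P' :=
  tendstoInDistribution_at_msWindow
    (T := fun (N : ℕ) W ω => Real.sqrt N * (τhat N W ω - τW W)) hclt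
    (fun N => (measurable_apply_dataIndex
      (fun W => ((hτm N W).sub_const _).const_mul _) (hWm N)).aemeasurable)
    hc hw hconv hsel

/-- The same with the FIXED centring `τ_w`: `√N (τ̂_N(Ŵ_N) − τ_w) ⇒ Z`. -/
theorem tendstoInDistribution_tauHat_at_msWindow_fixedCentre {Z : Ω' → ℝ}
    {τhat : ℕ → ℕ → Ω → ℝ} {τW : ℕ → ℝ} {c : ℝ} {w : ℕ} {Wsel : ℕ → Ω → ℕ}
    (hclt : TendstoInDistribution (fun (N : ℕ) ω => Real.sqrt N * (τhat N w ω - τW w)) atTop Z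
      (fun _ => P) P')
    (hτm : ∀ N W, Measurable (τhat N W)) (hWm : ∀ N, Measurable (Wsel N))
    (hc : 0 < c) (hw : IsStrictMSWindow c τW w)
    (hconv : ∀ W, 1 ≤ W → W ≤ w → TendstoInMeasure P (fun N => τhat N W) atTop fun _ => τW W)
    (hsel : ∀ N ω, IsMSWindow c (fun W => τhat N W ω) w → Wsel N ω = w) :
    TendstoInDistribution
      (fun (N : ℕ) ω => Real.sqrt N * (τhat N (Wsel N ω) ω - τW w)) atTop Z (fun _ => P) P' :=
  tendstoInDistribution_at_msWindow
    (T := fun (N : ℕ) W ω => Real.sqrt N * (τhat N W ω - τW w)) hclt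
    (fun N => (measurable_apply_dataIndex
      (fun W => ((hτm N W).sub_const _).const_mul _) (hWm N)).aemeasurable)
    hc hw hconv hsel

end AtWindow

/-! ## §5 Strictness is generic in `c` -/

section Generic

/-- An MS window at which the defining inequality is not an equality is a strict MS window. -/
theorem isStrictMSWindow_of_ne {c : ℝ} {τW : ℕ → ℝ} {w : ℕ} (h : IsMSWindow c τW w)
    (hne : c * τW w ≠ w) : IsStrictMSWindow c τW w :=
  ⟨h.1, lt_of_le_of_ne h.2.1 hne, h.2.2⟩

/-- **Strictness is generic**: for `c` outside the countable set `{W / τ_W : W ∈ ℕ}` every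
Madras–Sokal window of the curve `τW` at `c` is strict (at a tangential crossing `c τ_w = w` one has
`τ_w ≠ 0` because `w ≥ 1`, so `c = w/τ_w`). -/
theorem isStrictMSWindow_of_not_mem_range {c : ℝ} {τW : ℕ → ℝ} {w : ℕ} (h : IsMSWindow c τW w)
    (hc : c ∉ Set.range fun W : ℕ => (W : ℝ) / τW W) : IsStrictMSWindow c τW w := by
  refine isStrictMSWindow_of_ne h fun heq => hc ⟨w, ?_⟩
  have hw : (1 : ℝ) ≤ w := by exact_mod_cast h.1
  have hτ : τW w ≠ 0 := by
    intro h0; rw [h0, mul_zero] at heq; linarith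
  simp only
  rw [← heq, mul_div_assoc, div_self hτ, mul_one]

/-- The exceptional set of constants is countable … -/
theorem countable_range_window_div (τW : ℕ → ℝ) :
    (Set.range fun W : ℕ => (W : ℝ) / τW W).Countable :=
  Set.countable_range _

/-- … hence Lebesgue-null: the strict-crossing hypothesis of this file holds for almost every `c`. -/
theorem volume_range_window_div (τW : ℕ → ℝ) :
    volume (Set.range fun W : ℕ => (W : ℝ) / τW W) = 0 :=
  (countable_range_window_div τW).measure_zero volume

/-- **On C-1** (`ρ(t) = r^t`, `0 < r < 1`, where the MS window exists for every `c ≥ 0`,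
`exists_isMSWindow_geometric`): for every `c ≥ 0` off the countable exceptional set the population
curve `W ↦ τ_W` has a STRICT Madras–Sokal window — the hypothesis of §3–§4. -/
theorem exists_isStrictMSWindow_geometric {c r : ℝ} (hc : 0 ≤ c) (hr0 : 0 < r) (hr1 : r < 1)
    (hcr : c ∉ Set.range fun W : ℕ => (W : ℝ) / tauIntWindow (fun t => r ^ t) W) :
    ∃ W : ℕ, IsStrictMSWindow c (fun W => tauIntWindow (fun t => r ^ t) W) W := by
  obtain ⟨W, hW⟩ := exists_isMSWindow_geometric hc hr0 hr1
  exact ⟨W, isStrictMSWindow_of_not_mem_range hW hcr⟩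

end Generic

end Summit.Ventures.LatticeQCDFlow.Scoring

end
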